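import Literature.NumberTheory.Rogawski1990.ArchOrbFamGExtJumpNondeg                  -- ★ p851649 (this seat): (I₃) chain, nondegenerate frame — `hasOneSidedJump_hcTwistedDeriv_orbFamGExt_wall02_of_ne_zero`, `exists_archHCSpaceG_orbFamGExt_of_ne_zero`
import Literature.NumberTheory.Rogawski1990.ArchOrbFamGExtFaceJetBoundsNondeg         -- (this seat) (I₁) faces — `faceJetBounds_of_ne_zero`
import Literature.NumberTheory.Rogawski1990.ArchOrbFamGExtCentralJetBoundsNondeg      -- (this seat) (I₁) pure scalar corners — `exists_nhds_bddAbove_norm_iteratedFDeriv_orbFamGExt_of_scalarCorner_of_ne_zero`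
import Literature.NumberTheory.Rogawski1990.ArchOrbFamGExtCentralMixedJetBoundsNondeg -- ★ p851656 (F0P3a-p02 (g22)) (I₁) mixed scalar corners — `…_of_mixedCorner_normalised_of_ne_zero`, `centralMixedJetBounds_of_normalised_of_ne_zero`
import Literature.NumberTheory.Rogawski1990.ArchOrbFamGExtCrossCornerNondeg           -- ★ p851655 (F0P3a-p02 (g22)) (I₁) cross-place corners — `crossCornerJetBounds_of_ne_zero`
import Literature.NumberTheory.Rogawski1990.ArchOrbFamGExtSmoothInRegG                -- ★ p851150 (F0P3b-p01 (g16)) (I₂) `contDiffOn_orbFamGExt_inRegG` (hα hreal — nondegenerate already)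
import Literature.NumberTheory.Rogawski1990.ArchHCSmoothBoundedStrata                 -- ★ p851185∕p851201 (LH7-p04 (g4)) (I₁-asm) `smoothBounded_orbFamGExt_of_strata₄`
import HarnessLib

/-!
# LETTER L1 IN THE NONDEGENERATE DIAGONAL FRAME: `∃ jc′, ∀ a′ ∈ C_c^∞(G′_∞), orbFamGExt ν′ a′ ∈ ArchHCSpaceG (slotSign L α) jc′` for every real diagonal frame `diag α`,
# `α_i ≠ 0` — Harish-Chandra's (P)(W)(I₁)–(I₄) for the normalised orbital integrals of `U(diag α)(L⁺ ⊗ ℝ) ≅ ∏_w U(p_w, q_w)`, ANISOTROPY NOT ASSUMED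
# (Varadarajan 1977 I §1.12; Shelstad 1979 §4 Thm. 4.7; Bouaziz 1994 §3.1–3.2)

Topic `NumberTheory/Rogawski1990`; namespace `Literature.NumberTheory.Rogawski1990`.  THEOREMS ONLY (no `def`, no instance, no notation, no axiom, no named fact, no
`sorry`); kernel lane `--kind proof --supports stmt-HodgeConjecture-24833`.  Cell `pub/hodgecm-mathlib`, crux H413 (`stmt-HodgeConjecture-24833`); N8 ROAD CENSUS v0
(F0P3a-p02 (g22), `F0/P3a/F0P3a-p02/g22/N8-ROAD-CENSUS.v0.F0P3ap02g22.md` fd90e2d340c810dd) §4 CUT B ∕ §5 (1) «`hα`-twins of the L1 closers + the Literature-level L1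
head» — LEAD F0P3a-plan (g14) T13-42 priority item (5); co-hand split 14:06:39Z (CROSS + MIXED twins ↦ F0P3a-p02 (g22) ★ p851655∕p851656; JUMP ★ p851649 ∕ FACES ∕
CENTRAL ∕ this HEAD ↦ LH10-p02 (g8)).  Author LH10-p02 (g8).

THE HEAD **`exists_jc_archHCSpaceG_orbFamGExt_of_ne_zero (L α) [inst] (ν′) [Haar, right-invariant] (hherm) (hα : ∀ i, α i ≠ 0) :
  ∃ jc′, ∀ a′, ArchSmooth L 3 (diagonal α) a′ → ArchHCSpaceG (slotSign L α) jc′ (orbFamGExt L α ν′ a′)`** is the body of the `stub_N9` leaf's letter L1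
`HcOrbitalFamiliesStatement` (`Cruxes/H413/Lines/F0_P3c_StubN9Direct.lean` v12 :129) with its anisotropy binder `hanis` REPLACED by nondegeneracy `hα` — i.e. letter L1
for EVERY real diagonal frame, in particular for the ISOTROPIC quasi-split frame `β = (½, 1, −½)` of `G_∞ = U(Φ₃)_∞` (★ `formCongr_quasiSplitFrame_diagonal`; `hherm` ✓,
`hα` ✓, `hanis` ✗), which is what an in-house `G`-side road for row 2 (`stub_N8`, archimedean inner-form transfer) or for the `G`-side of rows 4∕5 imports first
(census §2 «ORDINARY orbital families of `a′` lie in HC's space» row, §4 CUT B).  PROOF = the leaf's kernel-checked composition `hcOrbitalFamilies_of_parts` ∘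
{`stub_N9hcSmoothInRegG`, `stub_N9hcJump`, `stub_N9hcFaceJetBounds`, `stub_N9hcCentralJetBounds`, `stub_N9hcCentralMixedJetBounds`, `stub_N9hcCrossCornerJetBounds`}
(v12 :304–318, :504–563) re-run on the `_of_ne_zero` twins: (I₂) ★ `contDiffOn_orbFamGExt_inRegG` (already `hα hreal`) on admissible labels and the zero family on junk
labels (★ `orbFamGExt_of_not_admissible`); (I₃) ★ `hasOneSidedJump_hcTwistedDeriv_orbFamGExt_wall02_of_ne_zero`; the four (I₁) wall strata ★ `faceJetBounds_of_ne_zero`,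
★ `…_of_scalarCorner_of_ne_zero`, ★ `centralMixedJetBounds_of_normalised_of_ne_zero` ∘ ★ `…_of_mixedCorner_normalised_of_ne_zero`, ★ `crossCornerJetBounds_of_ne_zero`,
assembled by ★ (I₁-asm) `smoothBounded_orbFamGExt_of_strata₄` and ★ `exists_archHCSpaceG_orbFamGExt_of_ne_zero` ((P)(W)(I₄) + `jc′` universality).  Zero new analysis.
Also: `smoothBounded_orbFamGExt_of_ne_zero` — the (I₁)+(I₂) package alone («every chart member is `C^∞` on `InRegG` with jets bounded on compacta»), for consumers
that want HC-smoothness without the jump datum.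
HONEST LABEL: count-neutral Literature insurance (no leaf, no letter, no books row; LH2 «§4 NO» unchanged); HC_CM is proved only modulo the 7 printed citations
(2 remaining: hLiu418 = `stmt-HodgeConjecture-24832`, h413 = `stmt-HodgeConjecture-24833`) until rung 0 closes.

## References
* [Varadarajan1977] V. S. Varadarajan, *Harmonic Analysis on Real Reductive Groups*, LNM 576 (1977), Part I §1.12 (the invariant integral `'F_f`: (P), (W), (I₁)–(I₄)).
* [Shelstad1979] D. Shelstad, *Characters and inner forms of a quasi-split group over ℝ*, Compositio Math. 39 (1979) 11–45, §4 pp. 22–25, Thm. 4.7 p. 31.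
* [Bouaziz1994IntegralesOrbitales] A. Bouaziz, *Intégrales orbitales sur les groupes de Lie réductifs*, Ann. Sci. ÉNS (4) 27 (1994) 573–609, §3.1–3.2 pp. 579–581.
* [Rogawski1990] J. D. Rogawski, *Automorphic Representations of Unitary Groups in Three Variables*, Ann. of Math. Stud. 123 (1990), §8.2 pp. 118–124; §14.2 p. 232.
-/

set_option autoImplicit false

noncomputable section

open MeasureTheory MeasureTheory.Measure NumberField NumberField.InfinitePlace Matrix Complex Set Filter Topology
open scoped MatrixGroups Matrix ContDiff Classical
open Literature.NumberTheory.Automorphic Literature.NumberTheory.Automorphic.UnitaryGroup Literature.NumberTheory.Automorphic.ArchCartan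
open Literature.NumberTheory.Automorphic.Shelstad1979.StableOrbitalIntegrals
open Literature.NumberTheory.GaloisRepresentations

namespace Literature.NumberTheory.Rogawski1990

section Head

variable (L : Type) [Field L] [NumberField L] [IsCMField L] (α : Fin 3 → L)
  [MeasurableSpace ↥(arch (↥(maximalRealSubfield L)) L (IsCMField.complexConj L) 3 (Matrix.diagonal α))] [BorelSpace ↥(arch (↥(maximalRealSubfield L)) L (IsCMField.complexConj L) 3 (Matrix.diagonal α))]
  (ν' : Measure ↥(arch (↥(maximalRealSubfield L)) L (IsCMField.complexConj L) 3 (Matrix.diagonal α))) [ν'.IsHaarMeasure] [ν'.IsMulRightInvariant]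

/-- **(I₂) ON EVERY LABEL, NONDEGENERATE FRAME**: every chart member of `orbFamGExt ν′ a′` is `C^∞` on `InRegG` — ★ `contDiffOn_orbFamGExt_inRegG` on admissible labels,
the zero family (★ `orbFamGExt_of_not_admissible`) on junk labels (twin of the leaf's `stub_N9hcSmoothInRegG`, `hanis` ↦ `hα`).
[cite: Bouaziz1994IntegralesOrbitales, §3.1 (I₂) p. 579] [cite: Varadarajan1977, I §1.12] -/
theorem contDiffOn_orbFamGExt_inRegG_all_of_ne_zero
    (hherm : ((Matrix.diagonal α).map (cmConjRingHom L)).transpose = Matrix.diagonal α) (hα : ∀ i, α i ≠ 0)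
    {a' : ↥(arch (↥(maximalRealSubfield L)) L (IsCMField.complexConj L) 3 (Matrix.diagonal α)) → ℂ} (ha' : ArchSmooth L 3 (Matrix.diagonal α) a')
    (S' : Finset {w : InfinitePlace L // IsComplex w}) :
    ContDiffOn ℝ ∞ (orbFamGExt L α ν' a' S') (InRegG (slotSign L α) S') := by
  by_cases hS' : ∀ w, w ∈ S' → w ∈ splitChartPlaces L α
  · have hreal : ∀ (w : {w : InfinitePlace L // IsComplex w}) (i : Fin 3), (w.1.embedding (α i)).im = 0 := fun w i =>
      im_embedding_diagonal_eq_zero L 3 α (complexConj_apply_eq_of_diagonal_frame hherm) w i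
    exact contDiffOn_orbFamGExt_inRegG L α ν' S' hα hreal hS' ha'
  · rw [orbFamGExt_of_not_admissible L α ν' a' S' hS']
    exact contDiffOn_const

/-- **(I₁)+(I₂) PACKAGE, NONDEGENERATE FRAME**: for every `a′ ∈ C_c^∞(G′_∞)` and every label `S′`, the chart member `orbFamGExt ν′ a′ S′` is `C^∞` on `InRegG` and each of its
jets is bounded on `K ∩ InRegG` for every compact `K` — ★ (I₁-asm) `smoothBounded_orbFamGExt_of_strata₄` fed with (I₂) and the four wall strata in their `_of_ne_zero` twins
(faces ★ `faceJetBounds_of_ne_zero`; pure scalar corners ★ `…_of_scalarCorner_of_ne_zero`; mixed scalar corners ★ `centralMixedJetBounds_of_normalised_of_ne_zero` ∘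
★ `…_of_mixedCorner_normalised_of_ne_zero`; cross-place corners ★ `crossCornerJetBounds_of_ne_zero`).  This is the `h1` input of ★ `exists_archHCSpaceG_orbFamGExt_of_ne_zero`.
[cite: Bouaziz1994IntegralesOrbitales, §3.1 (I₁)–(I₂) p. 579; §3.2 p. 580] [cite: Shelstad1979, §4 pp. 22–25] [cite: Varadarajan1977, I §1.12, §3] -/
theorem smoothBounded_orbFamGExt_of_ne_zero
    (hherm : ((Matrix.diagonal α).map (cmConjRingHom L)).transpose = Matrix.diagonal α) (hα : ∀ i, α i ≠ 0)
    {a' : ↥(arch (↥(maximalRealSubfield L)) L (IsCMField.complexConj L) 3 (Matrix.diagonal α)) → ℂ} (ha' : ArchSmooth L 3 (Matrix.diagonal α) a') :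
    ∀ S' : Finset {w : InfinitePlace L // IsComplex w}, ContDiffOn ℝ ∞ (orbFamGExt L α ν' a' S') (InRegG (slotSign L α) S') ∧
      ∀ (n : ℕ) (K : Set ({w : InfinitePlace L // IsComplex w} → Fin 3 → ℝ)), IsCompact K →
        BddAbove ((fun c => ‖iteratedFDeriv ℝ n (orbFamGExt L α ν' a' S') c‖) '' (K ∩ InRegG (slotSign L α) S')) :=
  smoothBounded_orbFamGExt_of_strata₄ L α ν' a'
    (contDiffOn_orbFamGExt_inRegG_all_of_ne_zero L α ν' hherm hα ha')
    (faceJetBounds_of_ne_zero L α ν' hherm hα ha')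
    (exists_nhds_bddAbove_norm_iteratedFDeriv_orbFamGExt_of_scalarCorner_of_ne_zero L α ν' hherm hα a' ha')
    (centralMixedJetBounds_of_normalised_of_ne_zero L α ν' hherm hα ha'
      (exists_nhds_bddAbove_norm_iteratedFDeriv_orbFamGExt_of_mixedCorner_normalised_of_ne_zero L α ν' hherm hα a' ha'))
    (crossCornerJetBounds_of_ne_zero L α ν' hherm hα ha')

/-- **LETTER L1 IN THE NONDEGENERATE DIAGONAL FRAME (Harish-Chandra; the HEAD of CUT B).**  For a CM field `L`, a real diagonal frame `diag α` (`hherm`) with `α_i ≠ 0`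
(`hα`; anisotropy NOT assumed) and a Haar measure `ν′` on `G′_∞ = U(diag α)(L⁺ ⊗ ℝ)`, there is ONE jump datum `jc′` such that for EVERY test function `a′ ∈ C_c^∞(G′_∞)` the
extended `R′`-normalised orbital-integral chart family `orbFamGExt ν′ a′` lies in Harish-Chandra's space `ArchHCSpaceG (slotSign L α) jc′` ((P) chart-periodicity, (W)
symmetries, (I₁) smooth on `InRegG` with one-sided limits of all jets at the walls, (I₃) the jump relations, (I₄) compact support).  = the `stub_N9` leaf's
`HcOrbitalFamiliesStatement` body with `hanis` ↦ `hα`; proof = the leaf's `hcOrbitalFamilies_of_parts` composition on the `_of_ne_zero` twins, through ★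
`exists_archHCSpaceG_orbFamGExt_of_ne_zero` ((I₁)+(I₂) package `smoothBounded_orbFamGExt_of_ne_zero`; (I₃) ★ `hasOneSidedJump_hcTwistedDeriv_orbFamGExt_wall02_of_ne_zero`).
[cite: Varadarajan1977, I §1.12] [cite: Shelstad1979, Thm. 4.7 (p. 31)] [cite: Bouaziz1994IntegralesOrbitales, §3.1–3.2 pp. 579–580; Thm. 3.2.1 p. 581] -/
theorem exists_jc_archHCSpaceG_orbFamGExt_of_ne_zero
    (hherm : ((Matrix.diagonal α).map (cmConjRingHom L)).transpose = Matrix.diagonal α) (hα : ∀ i, α i ≠ 0) :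
    ∃ jc' : Finset {w : InfinitePlace L // IsComplex w} → {w : InfinitePlace L // IsComplex w} → Fin 3 → Fin 3 → ℂ,
      ∀ a' : ↥(arch (↥(maximalRealSubfield L)) L (IsCMField.complexConj L) 3 (Matrix.diagonal α)) → ℂ, ArchSmooth L 3 (Matrix.diagonal α) a' →
        ArchHCSpaceG (slotSign L α) jc' (orbFamGExt L α ν' a') :=
  exists_archHCSpaceG_orbFamGExt_of_ne_zero L α ν' hherm hα
    (fun _ ha' => smoothBounded_orbFamGExt_of_ne_zero L α ν' hherm hα ha')
    (fun S' hS' w hw hwsp => hasOneSidedJump_hcTwistedDeriv_orbFamGExt_wall02_of_ne_zero L α ν' hherm hα S' hS' w hw hwsp)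

end Head

end Literature.NumberTheory.Rogawski1990

end
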